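import Literature.AnabelianGeometry.EtaleTheta.CyclotomicEnvelope
import Mathlib.Topology.Algebra.ContinuousMonoidHom
import Mathlib.Topology.LocallyConstant.Basic

/-!
# Mono-theta and bi-theta environments ([EtTh] §2, Definition 2.13)

Mochizuki, *The Étale Theta Function …* [EtTh], Publ. RIMS 45 (2009), §2, PRIMS text pp.45–48
(locators `p.N` = PDF pages; bib key `MochizukiEtTh2009`).

Contents (statements-first; definitions are real, printed results are named `Prop` facts):

* `TopOut.transport` — transport of outer automorphisms along an isomorphism of topological
  groups via Mathlib's `MulAut.congr` (bookkeeping for "maps `D_Π` to `D_{Π'}`", Def 2.13 (ii)).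
* `MonoThetaEnv`, `BiThetaEnv`, `MonoThetaEnv.Iso`, `BiThetaEnv.Iso` — the ABSTRACT data
  "(a topological group `Π`, a subgroup `D_Π ⊆ Out(Π)`, a collection of subgroups `s^Θ_Π`
  [and `s^alg_Π`])" and their isomorphisms (Def 2.13 (ii), (iii)).
* `ThetaEnvData N` — the INTERFACE ("the notation of the above discussion", pp.45–47) over
  which the MODEL environments are built (`Π^tp_X` for `X` of type `(1, (ℤ/lℤ)^Θ)` — double
  underline in print — with `G_K`, `Π^tp_Y ⊇ Π^tp_Ÿ`, `μ_N = ℤ/Nℤ(1)`, and the mod-`N`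
  reductions of the cocycles of the orbit `η̈^{Θ,l·ℤ×μ₂}`, pp.41, 46); the §1 objects belong to
  abc-iut-L2-t1 (`Setting.lean`) over abc-iut-L3-t2's `SemiGraphs.TemperedCurveData` —
  TODO-merge(abc-iut-L2-t1), TODO-merge(abc-iut-L3-t2). Nothing here asserts that such data
  exist for an actual Tate curve.
* `ThetaEnvData.env` = `Π^tp_Y[μ_N]` with its topology, the algebraic section `s^alg_Ÿ`, the
  theta sections `s^Θ_Ÿ` (p.46), the subgroup `D_Y ⊆ Out(Π^tp_Y[μ_N])` (Def 2.13 (i)), the MODEL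
  mono- and bi-theta environments (Def 2.13 (ii)(a)–(c), (iii)(a)–(d)), the predicates
  `IsMonoThetaEnv` / `IsBiThetaEnv` ("isomorphic to a model"); Def 2.13 (iv) is deferred (doc).

Design notes. (1) `D_Y` is "generated by the image of `K^×` and of `Gal(Y/X) ≅ l·ℤ`"; `K^×`
enters through the Kummer map `K^× ↠ H¹(G_K, μ_N) → H¹(Π^tp_Y, μ_N) → Out` (p.47), which is onto
`H¹(G_K, μ_N)`, so we generate by the shifts by all continuous `μ_N`-valued 1-cocycles inflated
from `G_K`. (2) Reductions `M_{N'}` / "morphisms" (Def 2.13 (ii)/(iii), last sentence) are not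
in this file. (3) ERRATUM context ([IUTchI] Rmk 3.1.6, kurims p.66): `l` is odd throughout.
-/

namespace Literature.AnabelianGeometry.EtaleTheta

universe u

/-! ## Transport of automorphisms along isomorphisms of topological groups -/

section Transport

variable {A B : Type*} [Group A] [Group B] [TopologicalSpace A] [TopologicalSpace B]

/-- Transport of automorphisms along an isomorphism of topological groups `e : A ≃ B`
(`φ ↦ e ∘ φ ∘ e⁻¹`, Mathlib's `MulAut.congr`) preserves bi-continuity.
[cite: MochizukiEtTh2009, Def 2.13(ii) p.47] -/
theorem conjAut_mem_contMulAut (e : A ≃ₜ* B) {φ : MulAut A} (hφ : φ ∈ contMulAut A) :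
    MulAut.congr e.toMulEquiv φ ∈ contMulAut B := by
  obtain ⟨h1, h2⟩ := hφ
  refine ⟨?_, ?_⟩
  · change Continuous fun b => e (φ (e.symm b))
    exact e.continuous.comp (h1.comp e.symm.continuous)
  · change Continuous fun b => e (φ.symm (e.symm b))
    exact e.continuous.comp (h2.comp e.symm.continuous)

/-- `MulAut.congr e` carries inner automorphisms to inner automorphisms:
`e ∘ conj(a) ∘ e⁻¹ = conj(e a)`. [cite: MochizukiEtTh2009, Def 2.13(ii) p.47] -/
theorem conjAut_conj (e : A ≃ₜ* B) (a : A) :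
    MulAut.congr e.toMulEquiv (MulAut.conj a) = MulAut.conj (e a) := by
  ext b
  simp [MulAut.conj_apply, map_mul, map_inv]
  rfl

/-- The restriction of `MulAut.congr e` to bi-continuous automorphisms.
[cite: MochizukiEtTh2009, Def 2.13(ii) p.47] -/
def conjContAut (e : A ≃ₜ* B) : contMulAut A →* contMulAut B :=
  ((MulAut.congr e.toMulEquiv).toMonoidHom.restrict (contMulAut A)).codRestrict (contMulAut B)
    (fun φ => conjAut_mem_contMulAut e φ.2)

/-- Transport of outer automorphisms `Out(A) → Out(B)` along `e : A ≃ B`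
(how an isomorphism of mono-theta environments "maps `D_Π` to `D_{Π'}`").
[cite: MochizukiEtTh2009, Def 2.13(ii) p.47] -/
def TopOut.transport (e : A ≃ₜ* B) : TopOut A →* TopOut B :=
  QuotientGroup.map (innerContAut A) (innerContAut B) (conjContAut e) (by
    rintro φ ⟨a, ha⟩
    refine ⟨e a, ?_⟩
    change MulAut.conj (e a) = MulAut.congr e.toMulEquiv φ.1
    rw [← conjAut_conj, ha]
    rfl)

end Transport

/-! ## Abstract mono- and bi-theta environments (Definition 2.13 (ii), (iii)) -/

/-- The data underlying a **[mod `N`] mono-theta environment**: "a topological group `Π`, a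
subgroup `D_Π ⊆ Out(Π)`, and a collection of subgroups `s^Θ_Π` of `Π`" (Def 2.13 (ii)); whether
such data IS a mono-theta environment (= is isomorphic to a model one) is the predicate
`ThetaEnvData.IsMonoThetaEnv`. [cite: MochizukiEtTh2009, Def 2.13(ii) p.47] -/
structure MonoThetaEnv : Type (u + 1) where
  /-- the topological group `Π` -/
  Pi : Type u
  [instGroup : Group Pi]
  [instTop : TopologicalSpace Pi]
  /-- the subgroup `D_Π ⊆ Out(Π)` -/
  D : Subgroup (TopOut Pi)
  /-- the collection of subgroups `s^Θ_Π` (a `μ_N`-conjugacy class in the model) -/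
  sTheta : Set (Subgroup Pi)

attribute [instance] MonoThetaEnv.instGroup MonoThetaEnv.instTop

/-- The data underlying a **[mod `N`] bi-theta environment**: a topological group `Π`, a subgroup
`D_Π ⊆ Out(Π)`, and an ORDERED pair of collections of subgroups `s^Θ_Π`, `s^alg_Π`
(Def 2.13 (iii)). [cite: MochizukiEtTh2009, Def 2.13(iii) p.48] -/
structure BiThetaEnv : Type (u + 1) where
  /-- the topological group `Π` -/
  Pi : Type u
  [instGroup : Group Pi]
  [instTop : TopologicalSpace Pi]
  /-- the subgroup `D_Π ⊆ Out(Π)` -/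
  D : Subgroup (TopOut Pi)
  /-- the collection of subgroups `s^Θ_Π` -/
  sTheta : Set (Subgroup Pi)
  /-- the collection of subgroups `s^alg_Π` -/
  sAlg : Set (Subgroup Pi)

attribute [instance] BiThetaEnv.instGroup BiThetaEnv.instTop

/-- A bi-theta environment determines a mono-theta environment by forgetting `s^alg`.
[cite: MochizukiEtTh2009, Def 2.13(iii) p.48] -/
def BiThetaEnv.toMono (B : BiThetaEnv.{u}) : MonoThetaEnv.{u} :=
  { Pi := B.Pi, D := B.D, sTheta := B.sTheta }

/-- An **isomorphism of [mod `N`] mono-theta environments** `M ≃ M'`: "any isomorphism of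
topological groups `Π ≃ Π'` that maps `D_Π ↦ D_{Π'}`, `s^Θ_Π ↦ s^Θ_{Π'}`".
[cite: MochizukiEtTh2009, Def 2.13(ii) p.48] -/
structure MonoThetaEnv.Iso (M M' : MonoThetaEnv.{u}) : Type u where
  /-- the isomorphism of topological groups -/
  e : M.Pi ≃ₜ* M'.Pi
  /-- `D_Π ↦ D_{Π'}` -/
  map_D : M.D.map (TopOut.transport e) = M'.D
  /-- `s^Θ_Π ↦ s^Θ_{Π'}` -/
  map_sTheta : (fun H => H.map e.toMulEquiv.toMonoidHom) '' M.sTheta = M'.sTheta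

/-- An **isomorphism of [mod `N`] bi-theta environments** `B ≃ B'`: an isomorphism of topological
groups mapping `D_Π ↦ D_{Π'}`, `s^Θ_Π ↦ s^Θ_{Π'}`, `s^alg_Π ↦ s^alg_{Π'}`.
[cite: MochizukiEtTh2009, Def 2.13(iii) p.48] -/
structure BiThetaEnv.Iso (B B' : BiThetaEnv.{u}) : Type u where
  /-- the isomorphism of topological groups -/
  e : B.Pi ≃ₜ* B'.Pi
  /-- `D_Π ↦ D_{Π'}` -/
  map_D : B.D.map (TopOut.transport e) = B'.D
  /-- `s^Θ_Π ↦ s^Θ_{Π'}` -/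
  map_sTheta : (fun H => H.map e.toMulEquiv.toMonoidHom) '' B.sTheta = B'.sTheta
  /-- `s^alg_Π ↦ s^alg_{Π'}` -/
  map_sAlg : (fun H => H.map e.toMulEquiv.toMonoidHom) '' B.sAlg = B'.sAlg

/-- The identity isomorphism of a mono-theta environment.
[cite: MochizukiEtTh2009, Def 2.13(ii) p.48] -/
def MonoThetaEnv.Iso.refl (M : MonoThetaEnv.{u}) : M.Iso M where
  e := ContinuousMulEquiv.refl M.Pi
  map_D := by
    have : TopOut.transport (ContinuousMulEquiv.refl M.Pi) = MonoidHom.id _ := by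
      ext ⟨φ⟩; rfl
    rw [this]; exact Subgroup.map_id _
  map_sTheta := by
    have : (fun H : Subgroup M.Pi =>
        H.map (ContinuousMulEquiv.refl M.Pi).toMulEquiv.toMonoidHom) = id := by
      funext H; exact Subgroup.map_id H
    rw [this, Set.image_id]

/-! ## The topology of the cyclotomic envelope -/

/-- The topology on `Π[μ_N] = μ_N ⋊ Π`: the product topology transported along
`Π[μ_N] ≃ μ_N × Π` (`μ_N` finite discrete in the applications). SCOPED to this namespace
(`open scoped Literature.AnabelianGeometry.EtaleTheta` downstream) since `CycEnvelope` is an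
`abbrev` of `SemidirectProduct`. [cite: MochizukiEtTh2009, Def 2.13(ii)(a) p.47] -/
scoped instance instTopologicalSpaceCycEnvelope {P G μ : Type*} [Group P] [Group G] [CommGroup μ]
    (aug : P →* G) (χ : G →* MulAut μ) [TopologicalSpace P] [TopologicalSpace μ] :
    TopologicalSpace (CycEnvelope aug χ) :=
  TopologicalSpace.induced (fun x => (x.left, x.right)) inferInstance

/-- The projection `Π[μ_N] → Π` is continuous. [cite: MochizukiEtTh2009, Def 2.13(ii)(a) p.47] -/
theorem CycEnvelope.continuous_proj {P G μ : Type*} [Group P] [Group G] [CommGroup μ]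
    (aug : P →* G) (χ : G →* MulAut μ) [TopologicalSpace P] [TopologicalSpace μ] :
    Continuous (CycEnvelope.proj aug χ) :=
  (continuous_snd.comp continuous_induced_dom :
    Continuous (Prod.snd ∘ fun x : CycEnvelope aug χ => (x.left, x.right)))

/-! ## The model data (pp.45–47) -/

/-- **Interface: "the notation of the above discussion"** (pp.45–47) for a smooth log curve `X` of
type `(1, (ℤ/lℤ)^Θ)` (double-underlined `X` in print) over a finite extension `K = K̈` of `ℚ_p`,
`l` and `p` odd, at level `N`: `Π^tp_X ↠ G_K` (p.35), `Π^tp_Y ⊇ Π^tp_Ÿ` (p.41, p.47), the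
cyclotome `Δ_{μ_N} = ℤ/Nℤ(1)` with its `G_K`-action (p.44), and "the reduction modulo `N` of
[the cocycles determined by] the collection of classes `η̈^{Θ,l·ℤ×μ₂} ⊆ H¹(Π^tp_Ÿ, l·Δ_Θ)`",
transported to `μ_N` via "the natural isomorphism `μ_N ≅ (l·Δ_Θ) ⊗ (ℤ/Nℤ)`" (p.46), closed under
coboundaries ("conjugation by an element of `μ_N` corresponds precisely to modifying a cocycle by
a coboundary", p.47). TODO-merge(abc-iut-L2-t1): `PiX … PiYdd`, `η̈` come from
`EtaleTheta/Setting.lean`; TODO-merge(abc-iut-L3-t2): `PiX = SemiGraphs.TemperedCurveData.Gtp`.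
[cite: MochizukiEtTh2009, Def 2.13 p.47] -/
structure ThetaEnvData (N : ℕ+) : Type (u + 1) where
  /-- `Π^tp_X`, the tempered fundamental group of `X` of type `(1, (ℤ/lℤ)^Θ)` (p.45) -/
  PiX : Type u
  [grpPiX : Group PiX]
  [topPiX : TopologicalSpace PiX]
  [tgPiX : IsTopologicalGroup PiX]
  /-- `G_K = Gal(K̄/K)` (p.35) -/
  G : Type u
  [grpG : Group G]
  /-- the augmentation `Π^tp_X ↠ G_K` (p.35) -/
  aug : PiX →* G
  /-- "`1 → Δ_X → Π_X → G_K → 1`" is exact on the right (p.35) -/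
  aug_surjective : Function.Surjective aug
  /-- `Π^tp_Y ⊆ Π^tp_X` (the covering `Y → X`, p.41) -/
  PiY : Subgroup PiX
  /-- `Π^tp_Y` is normal in `Π^tp_X` (`Y → X` Galois, p.47) -/
  PiY_normal : PiY.Normal
  /-- `Π^tp_Y` is open (tempered covering) -/
  PiY_open : IsOpen (PiY : Set PiX)
  /-- "`Gal(Y/X) (≅ l·ℤ)`" (Def 2.13 (i), p.47): an identification of `Π^tp_X/Π^tp_Y` with `ℤ` -/
  galYX : PiX ⧸ PiY ≃* Multiplicative ℤ
  /-- `Π^tp_Ÿ ⊆ Π^tp_X` (the covering `Ÿ → Y` of p.41) -/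
  PiYdd : Subgroup PiX
  /-- `Π^tp_Ÿ ⊆ Π^tp_Y` (p.41) -/
  PiYdd_le : PiYdd ≤ PiY
  /-- `Π^tp_Ÿ` is normal in `Π^tp_X` ("`Π^tp_X/Π^tp_Ÿ ≅ (l·ℤ) × μ₂`", p.41) -/
  PiYdd_normal : PiYdd.Normal
  /-- `Π^tp_Ÿ` is open -/
  PiYdd_open : IsOpen (PiYdd : Set PiX)
  /-- "`Π^tp_X/Π^tp_Ÿ ≅ (l·ℤ) × μ₂`" (p.41): `Π^tp_Ÿ` has index `2` in `Π^tp_Y` -/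
  index_PiYdd : (PiYdd.subgroupOf PiY).index = 2
  /-- the cyclotome `Δ_{μ_N} = ℤ/Nℤ(1)` (p.44), written multiplicatively -/
  mu : Type u
  [cgMu : CommGroup mu]
  [topMu : TopologicalSpace mu]
  [discMu : DiscreteTopology mu]
  [finMu : Fintype mu]
  /-- `μ_N` is cyclic … -/
  mu_cyclic : IsCyclic mu
  /-- … of order `N` -/
  card_mu : Fintype.card mu = N
  /-- the action of `G_K` on `ℤ/Nℤ(1)` (the mod-`N` cyclotomic character, p.44) -/
  chi : G →* MulAut mu
  /-- continuity of the action: its kernel in `Π^tp_X` is open -/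
  chi_ker_open : IsOpen (((chi.comp aug).ker : Subgroup PiX) : Set PiX)
  /-- the mod-`N` reductions of the cocycles representing the classes `η̈^{Θ,l·ℤ×μ₂}`, viewed in
  `μ_N ≅ (l·Δ_Θ) ⊗ ℤ/Nℤ` (p.46) -/
  thetaCocycles : Set (PiYdd → mu)
  /-- the collection is nonempty (p.41: `η̈^Θ` exists) -/
  thetaCocycles_nonempty : thetaCocycles.Nonempty
  /-- each member is a 1-cocycle of `Π^tp_Ÿ` with coefficients in `μ_N` (p.46) -/
  isCocycle : ∀ η ∈ thetaCocycles, CycEnvelope.IsEnvCocycle (aug.comp PiYdd.subtype) chi η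
  /-- each member is continuous (`H¹` of the TEMPERED group, p.41) -/
  locallyConstant : ∀ η ∈ thetaCocycles, IsLocallyConstant η
  /-- the collection consists of full cohomology classes: closed under coboundaries (p.47) -/
  mul_coboundary_mem : ∀ η ∈ thetaCocycles, ∀ c : mu,
    η * CycEnvelope.coboundary (aug.comp PiYdd.subtype) chi c ∈ thetaCocycles

attribute [instance] ThetaEnvData.grpPiX ThetaEnvData.topPiX ThetaEnvData.tgPiX
  ThetaEnvData.grpG ThetaEnvData.cgMu ThetaEnvData.topMu ThetaEnvData.discMu ThetaEnvData.finMu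

namespace ThetaEnvData

variable {N : ℕ+} (T : ThetaEnvData.{u} N)

/-- The augmentation of `Π^tp_Y`. [cite: MochizukiEtTh2009, Def 2.13 p.47] -/
abbrev augY : T.PiY →* T.G := T.aug.comp T.PiY.subtype

/-- **`Π^tp_Y[μ_N]`**, the cyclotomic envelope of `Π^tp_Y ↠ G_K` (Def 2.13 (ii)(a)), with the
topology of `μ_N × Π^tp_Y`. [cite: MochizukiEtTh2009, Def 2.13(ii) p.47] -/
abbrev env : Type u := CycEnvelope T.augY T.chi

/-- The inclusion `Π^tp_Ÿ ↪ Π^tp_Y`. [cite: MochizukiEtTh2009, p.46] -/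
abbrev inclYdd : T.PiYdd →* T.PiY := Subgroup.inclusion T.PiYdd_le

/-- The **[mod `N`] algebraic section** `s^alg_Ÿ : Π^tp_Ÿ → Π^tp_Y[μ_N]`, the restriction to
`Π^tp_Ÿ` of the tautological section (Def 2.13 (i)). [cite: MochizukiEtTh2009, Def 2.13(i) p.47] -/
def sAlg : T.PiYdd →* T.env := (CycEnvelope.algSection T.augY T.chi).comp T.inclYdd

/-- The **[mod `N`] theta section** `s^Θ_Ÿ : Π^tp_Ÿ → Π^tp_Y[μ_N]` attached to a cocycle `η`
of the collection: obtained "by subtracting" `η` from `s^alg_Ÿ`, i.e. `g ↦ η(g)⁻¹ · s^alg(g)`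
(p.46; a homomorphism by the cocycle identity). [cite: MochizukiEtTh2009, Def 2.13(i) p.47] -/
def sTheta {η : T.PiYdd → T.mu} (hη : η ∈ T.thetaCocycles) : T.PiYdd →* T.env where
  toFun g := ⟨(η g)⁻¹, T.inclYdd g⟩
  map_one' := by
    have h1 : η 1 = 1 := by
      have := T.isCocycle η hη 1 1
      simp only [mul_one, map_one, MulAut.one_apply] at this
      exact mul_eq_left.mp this.symm
    ext <;> simp [h1]
  map_mul' g h := by
    have hc := T.isCocycle η hη g h
    ext
    · simp only [SemidirectProduct.mul_left, MonoidHom.coe_comp, Function.comp_apply, hc,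
        mul_inv_rev, map_inv]
      rw [mul_comm]
      rfl
    · simp

/-- The automorphism of `Π^tp_Y[μ_N] = μ_N ⋊ Π^tp_Y` induced by conjugation by `g ∈ Π^tp_X`
(acting on `Π^tp_Y` by conjugation and on `μ_N` through `χ(aug g)`): the outer action of
`Gal(Y/X) = Π^tp_X/Π^tp_Y` on `Π^tp_Y[μ_N]` (p.46 bottom).
[cite: MochizukiEtTh2009, Def 2.13(i) p.47] -/
def conjX (g : T.PiX) : MulAut T.env where
  toFun x := ⟨T.chi (T.aug g) x.left,
    ⟨g * x.right * g⁻¹, T.PiY_normal.conj_mem _ x.right.2 g⟩⟩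
  invFun x := ⟨T.chi (T.aug g⁻¹) x.left,
    ⟨g⁻¹ * x.right * g, by simpa using T.PiY_normal.conj_mem _ x.right.2 g⁻¹⟩⟩
  left_inv x := by
    ext
    · simp [map_inv]
    · simp [mul_assoc]
  right_inv x := by
    ext
    · simp [map_inv]
    · simp [mul_assoc]
  map_mul' x y := by
    ext
    · simp only [SemidirectProduct.mul_left, map_mul, MonoidHom.coe_comp, Function.comp_apply,
        Subgroup.coe_subtype]
      congr 1
      rw [← MulAut.mul_apply, ← MulAut.mul_apply, map_inv, map_inv, inv_mul_cancel_right]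
    · simp [mul_assoc]

/-- The **Kummer part of `D_Y`**: outer automorphisms of `Π^tp_Y[μ_N]` given by shifting by a
continuous `μ_N`-valued 1-cocycle INFLATED FROM `G_K` — the image of
`K^× → H¹(G_K, μ_N) → H¹(Π^tp_Y, μ_N) → Out(Π^tp_Y[μ_N])` (p.47; the Kummer map of `K` is onto
`H¹(G_K, μ_N)`). [cite: MochizukiEtTh2009, Def 2.13(i) p.47] -/
def kummerOut : Set (TopOut T.env) :=
  {x | ∃ (δ : T.G → T.mu) (hδ : CycEnvelope.IsEnvCocycle T.augY T.chi (δ ∘ T.augY))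
      (hc : CycEnvelope.shift hδ ∈ contMulAut T.env), x = TopOut.mk _ ⟨_, hc⟩}

/-- The **`Gal(Y/X)` part of `D_Y`**: outer automorphisms of `Π^tp_Y[μ_N]` induced by conjugation
by elements of `Π^tp_X` (p.46). [cite: MochizukiEtTh2009, Def 2.13(i) p.47] -/
def galOut : Set (TopOut T.env) :=
  {x | ∃ (g : T.PiX) (hc : T.conjX g ∈ contMulAut T.env), x = TopOut.mk _ ⟨_, hc⟩}

/-- **Definition 2.13 (i)**: `D_Y ⊆ Out(Π^tp_Y[μ_N])`, "the subgroup generated by the image of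
`K^×`, `Gal(Y/X) (≅ l·ℤ)`". [cite: MochizukiEtTh2009, Def 2.13(i) p.47] -/
def DY : Subgroup (TopOut T.env) := Subgroup.closure (T.kummerOut ∪ T.galOut)

/-- **Definition 2.13 (ii) (a)–(c)**: the **[mod `N`] model mono-theta environment**
`(Π^tp_Y[μ_N], D_Y, μ_N-conjugacy class of Im(s^Θ_Ÿ))` attached to a cocycle of the collection.
[cite: MochizukiEtTh2009, Def 2.13(ii) p.47] -/
abbrev modelMono {η : T.PiYdd → T.mu} (hη : η ∈ T.thetaCocycles) : MonoThetaEnv.{u} where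
  Pi := T.env
  D := T.DY
  sTheta := CycEnvelope.muConjClass T.augY T.chi (T.sTheta hη).range

/-- **Definition 2.13 (iii) (a)–(d)**: the **[mod `N`] model bi-theta environment**
`(Π^tp_Y[μ_N], D_Y, [Im s^Θ_Ÿ], [Im s^alg_Ÿ])`. [cite: MochizukiEtTh2009, Def 2.13(iii) p.48] -/
abbrev modelBi {η : T.PiYdd → T.mu} (hη : η ∈ T.thetaCocycles) : BiThetaEnv.{u} where
  Pi := T.env
  D := T.DY
  sTheta := CycEnvelope.muConjClass T.augY T.chi (T.sTheta hη).range
  sAlg := CycEnvelope.muConjClass T.augY T.chi T.sAlg.range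

/-- **Definition 2.13 (ii)**: a collection of data `M = (Π, D_Π, s^Θ_Π)` IS a [mod `N`]
mono-theta environment (for the given curve data) if it is isomorphic to a model one.
[cite: MochizukiEtTh2009, Def 2.13(ii) p.47] -/
def IsMonoThetaEnv (M : MonoThetaEnv.{u}) : Prop :=
  ∃ (η : T.PiYdd → T.mu) (hη : η ∈ T.thetaCocycles), Nonempty (M.Iso (T.modelMono hη))

/-- **Definition 2.13 (iii)**: `B = (Π, D_Π, s^Θ_Π, s^alg_Π)` IS a [mod `N`] bi-theta environment
if it is isomorphic to a model one. [cite: MochizukiEtTh2009, Def 2.13(iii) p.48] -/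
def IsBiThetaEnv (B : BiThetaEnv.{u}) : Prop :=
  ∃ (η : T.PiYdd → T.mu) (hη : η ∈ T.thetaCocycles), Nonempty (B.Iso (T.modelBi hη))

/-- "In particular, every model mono-theta environment determines a mono-theta environment."
[cite: MochizukiEtTh2009, Def 2.13(ii) p.47] -/
theorem isMonoThetaEnv_modelMono {η : T.PiYdd → T.mu} (hη : η ∈ T.thetaCocycles) :
    T.IsMonoThetaEnv (T.modelMono hη) :=
  ⟨η, hη, ⟨MonoThetaEnv.Iso.refl _⟩⟩

end ThetaEnvData

/-! ### Definition 2.13 (iv) (p.48): "if `η̈^{Θ,l·ℤ×μ₂}` is of standard type, then we shall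
refer to the resulting model bi-theta environment as being of standard type" — DEFERRED: it is the
hypothesis `(h : IsStandardType …)` on the orbit, to be typed against abc-iut-L2-t1's Def 1.9 (ii) /
Def 2.7 predicate when it lands (no free `Prop` stub here, per review of p404057). -/

end Literature.AnabelianGeometry.EtaleTheta
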